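import Literature.Computability.Complexity.StackNumeric
import Literature.Computability.Complexity.StackGcd
import Literature.Computability.Complexity.StackItemLists
import HarnessLib

/-!
# Verified arithmetic on stack programs: the greatest common divisor in the numeric procedure layer

Literature / complexity toolkit, continuing `StackNumeric.lean` (the procedure layer: operands in
outer registers, `Runs (nOp …) (base T) (base T') cost`) and `StackGcd.lean` (`Com.gcdXY`:
Euclid's algorithm on the arithmetic bank with a clock in three outer registers, over `κ ⊕ AReg`).
The procedure layer had no gcd; this file lifts `gcdXY` into it, the way `nMul` lifts the
multiplication bank routine: the clock registers are taken in the (idle) multiplication bank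
`MOwn`, the whole routine is embedded along `gcdEmb : MOwn ⊕ AReg → EReg ⊕ β` (`Runs.map`,
`graft_gcdEmb`), operands are copied in and the result moved out:

* `Com.nGcd dst a b` and **`Com.runs_nGcd`**: for numerals `a = encodeNat x`, `b = encodeNat y`
  of length `≤ n` (preserved), `dst := encodeNat (gcd x y)` within `1000 (n+1)³` steps.

## References

* T. H. Cormen, C. E. Leiserson, R. L. Rivest, C. Stein, *Introduction to Algorithms*, 3rd ed.,
  MIT Press 2009, §31.2 (EUCLID; Lemma 31.10, Thm. 31.11). [CLRS2009]
* D. E. Knuth, *The Art of Computer Programming*, Vol. 2, 3rd ed., 1998, §4.5.2.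
-/

namespace Literature.Computability.Complexity

open _root_.Computability SProg

namespace Com

variable {β : Type}

/-- The registers of the gcd routine (`κ ⊕ AReg` with `κ := MOwn` for the clock and latch) inside
the numeric layer. [folklore] -/
def gcdEmb : MOwn ⊕ AReg → EReg ⊕ β
  | .inl k => rm k
  | .inr a => ra a

/-- `gcdEmb` is injective. [folklore] -/
theorem gcdEmb_injective : Function.Injective (gcdEmb (β := β)) := by
  intro i j h
  rcases i with i | i <;> rcases j with j | j <;> simp [gcdEmb, rm, ra] at h <;> simp [h]

variable [DecidableEq β]

/-- `nGcd dst a b`: `dst :=` the numeral of `gcd a b` (operands numerals, preserved).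
[cite: CLRS2009, §31.2 (EUCLID)] -/
def nGcd (dst a b : β) : Com (EReg ⊕ β) :=
  copy (Sum.inr a) (ra .x) (ra .t) (ra .u) ;; (copy (Sum.inr b) (ra .y) (ra .t) (ra .u) ;;
  ((gcdXY (κ := MOwn) .p .q .r).map gcdEmb ;; (clear (rm .r) ;; (clear (Sum.inr dst) ;; move (ra .x) (Sum.inr dst) (ra .s)))))

omit [DecidableEq β] in
/-- The grafted final state of the gcd routine is a numeric-layer state. [folklore] -/
theorem graft_gcdEmb (A : Regs AReg) (M : Regs MOwn) (T : Regs β) (M' : Regs MOwn) (A' : Regs AReg) :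
    graft (nst A M eClean T) gcdEmb (Sum.elim M' A') = nst A' M' eClean T := by
  funext k
  rcases k with ((r | m) | eo) | b
  · rw [show (Sum.inl (Sum.inl (Sum.inl r)) : EReg ⊕ β) = gcdEmb (.inr r) from rfl, graft_apply _ gcdEmb_injective]; rfl
  · rw [show (Sum.inl (Sum.inl (Sum.inr m)) : EReg ⊕ β) = gcdEmb (.inl m) from rfl, graft_apply _ gcdEmb_injective]; rfl
  · rw [graft_of_not _ _ _ (fun i => by rcases i with i | i <;> simp [gcdEmb, rm, ra])]; rfl
  · rw [graft_of_not _ _ _ (fun i => by rcases i with i | i <;> simp [gcdEmb, rm, ra])]; rfl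

/-- **Simulation of `nGcd`**, in `1000 (n + 1)³` steps on numerals of length `≤ n`.
[cite: CLRS2009, §31.2 (Thm. 31.11)] -/
theorem runs_nGcd (dst a b : β) (T : Regs β) {x y n : ℕ} (ha : T a = encodeNat x) (hb : T b = encodeNat y)
    (hxn : (encodeNat x).length ≤ n) (hyn : (encodeNat y).length ≤ n) (hd : (T dst).length ≤ n) :
    Runs (nGcd dst a b) (base T) (base (Function.update T dst (encodeNat (Nat.gcd x y)))) (1000 * (n + 1) ^ 3) := by
  have h1 : Runs (copy (Sum.inr a) (ra .x) (ra .t) (ra .u)) (base T)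
      (nst (AReg.file (encodeNat x) [] [] [] [] [] [] []) mClean eClean T) (10 * (encodeNat x).length + 3) :=
    (runs_copy (by simp [ra]) (by simp [ra]) (by simp [ra]) (by simp [ra]) (by simp [ra]) (by simp [ra])
      (base T) rfl rfl).of_eq (by simp [ha]) (by simp [ha])
  have h2 : Runs (copy (Sum.inr b) (ra .y) (ra .t) (ra .u)) (nst (AReg.file (encodeNat x) [] [] [] [] [] [] []) mClean eClean T)
      (nst (AReg.file (encodeNat x) (encodeNat y) [] [] [] [] [] []) mClean eClean T) (10 * (encodeNat y).length + 3) :=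
    (runs_copy (by simp [ra]) (by simp [ra]) (by simp [ra]) (by simp [ra]) (by simp [ra]) (by simp [ra])
      _ rfl rfl).of_eq (by simp [hb]) (by simp [hb])
  have hg := runs_gcdXY (κ := MOwn) (fuel := .p) (m := .q) (d := .r) (by decide) (by decide) (by decide) mClean rfl rfl rfl
    (encodeNat x) (encodeNat y) [] (norm_encodeNat x) (norm_encodeNat y)
  rw [bitsToNat_encodeNat, bitsToNat_encodeNat] at hg
  have h3 : Runs ((gcdXY (κ := MOwn) .p .q .r).map gcdEmb) (nst (AReg.file (encodeNat x) (encodeNat y) [] [] [] [] [] []) mClean eClean T)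
      (nst (AReg.file (encodeNat (Nat.gcd x y)) [] [] [] [] [] [] []) (Function.update mClean .r [true]) eClean T)
      ((2 * (encodeNat y).length + 1) * (euclidCost ((encodeNat x).length + (encodeNat y).length) + 2) + 20 * (encodeNat y).length + 8) := by
    have hm := Runs.map gcdEmb_injective hg (nst (AReg.file (encodeNat x) (encodeNat y) [] [] [] [] [] []) mClean eClean T)
      (fun i => by rcases i with i | i <;> rfl)
    rwa [graft_gcdEmb] at hm
  have h4 : Runs (clear (rm .r)) (nst (AReg.file (encodeNat (Nat.gcd x y)) [] [] [] [] [] [] []) (Function.update mClean .r [true]) eClean T)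
      (nst (AReg.file (encodeNat (Nat.gcd x y)) [] [] [] [] [] [] []) mClean eClean T) 3 :=
    (runs_clear (rm .r) _).of_eq (by simp [rm]) (by simp [rm])
  have h5 : Runs (clear (Sum.inr dst)) (nst (AReg.file (encodeNat (Nat.gcd x y)) [] [] [] [] [] [] []) mClean eClean T)
      (nst (AReg.file (encodeNat (Nat.gcd x y)) [] [] [] [] [] [] []) mClean eClean (Function.update T dst [])) (2 * (T dst).length + 1) :=
    (runs_clear (Sum.inr dst) _).of_eq (by simp) (by simp)
  have h6 : Runs (move (ra .x) (Sum.inr dst) (ra .s))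
      (nst (AReg.file (encodeNat (Nat.gcd x y)) [] [] [] [] [] [] []) mClean eClean (Function.update T dst []))
      (base (Function.update T dst (encodeNat (Nat.gcd x y)))) (6 * (encodeNat (Nat.gcd x y)).length + 2) :=
    (runs_move (by simp [ra]) (by simp [ra]) (by simp [ra]) _ rfl).of_eq (by simp) (by simp)
  refine (h1.seq (h2.seq (h3.seq (h4.seq (h5.seq h6))))).of_eq rfl ?_
  have hgl : (encodeNat (Nat.gcd x y)).length ≤ n := by
    rcases Nat.eq_zero_or_pos x with rfl | hx
    · rw [Nat.gcd_zero_left]; exact hyn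
    · exact (Brick.length_encodeNat_mono (Nat.gcd_le_left y hx)).trans hxn
  have hL : (encodeNat x).length + (encodeNat y).length ≤ 2 * n := by omega
  have hE : euclidCost ((encodeNat x).length + (encodeNat y).length) + 2 ≤ 164 * n ^ 2 + 126 * n + 14 := by
    unfold euclidCost
    have := Nat.mul_le_mul hL (show 41 * ((encodeNat x).length + (encodeNat y).length) + 48 ≤ 41 * (2 * n) + 48 by omega)
    nlinarith [this, hL]
  have hP : (2 * (encodeNat y).length + 1) * (euclidCost ((encodeNat x).length + (encodeNat y).length) + 2) ≤
      (2 * n + 1) * (164 * n ^ 2 + 126 * n + 14) := Nat.mul_le_mul (by omega) hE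
  nlinarith [hP, hxn, hyn, hd, hgl]

end Com

end Literature.Computability.Complexity
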